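import Summits.AtomisticToContinuum.HydrodynamicLimit.Theorems.JParityClosureEvenStressEnskogRungZeroPinHelpers
import Summits.AtomisticToContinuum.HydrodynamicLimit.Theorems.JParityClosureOddContactSymmetryL2ToProbability
import HarnessLib

/-!
# The rung-0 law of large numbers, the bump, and the continuity of the contact value behind the
# identification lemma (Pin) of the crux line `liouville-continuity-pins-universal-contact-value`
# (`JParityClosure.EvenStressEnskog`, stmt-AtomisticToContinuum-13079)

(1) Under the flow-invariant rung-0 Gibbs law `G_N = localGibbsLaw σ 1 0 1 N (Φ N)` the TIME AVERAGE
along the flow of the weighted rate `w(z) = ∫ ψ(σ³ρ_r(z,x)) B_r(Ξ_L^{kk})(z,x) dx` (continuous bounded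
weight `ψ` with `ψ(σ³) = 1`) stays within `Θ̄/2` of the Maxwellian pair average
`Θ̄ = ∫ Θ(Ξ_L^{kk}) d(N(0,1) ⊗ N(0,1))` with `G_N`-probability `≥ 3/4` for `N` large:
the static mean-square deviation `∫∫ (ψ(σ³ρ_r) B_r − Θ̄)² → 0`
(`tendsto_integral_integral_sq_deviation`) controls, by Jensen over the torus, both the static mean
and the static variance of `w`, which are the transported ones by invariance
(`integral_comp_flow_localGibbsLaw_const`, `MeasurePreserving.variance_fun_comp`); the tree's
`measure_lt_abs_setIntegral_flow_le` (Cauchy–Schwarz in time + Chebyshev) concludes.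
(2) `exists_bump_weights`: the piecewise-linear bump `g` at `η⋆` and the continuous bounded weights
`wᵢ = g·Fᵢ` for two laws continuous near `η⋆`.  (3) `continuousOn_contactValue_band`: the contact value
is continuous on the open analyticity band of the equation of state (`HsEosLowDensity_holds`).
-/

noncomputable section

open MeasureTheory ProbabilityTheory Set Filter Topology
open scoped ENNReal InnerProductSpace BigOperators

namespace Summit.AtomisticToContinuum.HydrodynamicLimit.Theorems.EvenStressEnskog

open Literature.Analysis.FluidPDE Literature.MathematicalPhysics.KineticTheory
open Literature.MathematicalPhysics.StatisticalMechanics Literature.Probability.Moments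
open Summit.AtomisticToContinuum.HydrodynamicLimit.Theses.JParityClosure

/-- **Mean-square deviation of a `ν`-average from a constant** is at most the `ν`-average of the
pointwise mean-square deviations (Jensen over the probability space `ν`, then Fubini):
`∫ (∫ F(ω,x) dν − c)² dμ ≤ ∫_x ∫_ω (F(ω,x) − c)² dμ dν` for a jointly measurable bounded `F`
(proof adapted from `Literature.Probability.Moments.variance_integral_le_integral_integral_sq`).
[folklore] -/
theorem integral_sq_integral_sub_const_le {Ω X : Type*} [MeasurableSpace Ω] [MeasurableSpace X]
    {μ : Measure Ω} [IsProbabilityMeasure μ] {ν : Measure X} [IsProbabilityMeasure ν]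
    {F : Ω → X → ℝ} (hF : Measurable (Function.uncurry F)) {C : ℝ} (hC : ∀ ω x, |F ω x| ≤ C)
    (c : ℝ) :
    ∫ ω, (∫ x, F ω x ∂ν - c) ^ 2 ∂μ ≤ ∫ x, ∫ ω, (F ω x - c) ^ 2 ∂μ ∂ν := by
  have hhm : Measurable (Function.uncurry fun ω x => F ω x - c) := hF.sub measurable_const
  have hhb : ∀ ω x, |F ω x - c| ≤ C + |c| := fun ω x =>
    (abs_sub _ _).trans (add_le_add (hC ω x) le_rfl)
  have hFint : ∀ ω, Integrable (F ω) ν := fun ω =>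
    Integrable.of_bound hF.of_uncurry_left.aestronglyMeasurable C
      (Eventually.of_forall fun x => by simpa only [Real.norm_eq_abs] using hC ω x)
  have hpt : ∀ ω, (∫ x, F ω x ∂ν - c) ^ 2 ≤ ∫ x, (F ω x - c) ^ 2 ∂ν := fun ω => by
    have e : ∫ x, F ω x ∂ν - c = ∫ x, (F ω x - c) ∂ν := by
      rw [integral_sub (hFint ω) (integrable_const c), integral_const, probReal_univ, one_smul]
    rw [e]
    exact sq_integral_le_integral_sq_of_abs_le (hhm.of_uncurry_left (x := ω)) (hhb ω)
  have hprod : Integrable (Function.uncurry fun ω x => (F ω x - c) ^ 2) (μ.prod ν) :=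
    Integrable.of_bound (hhm.pow_const 2).aestronglyMeasurable ((C + |c|) ^ 2)
      (Eventually.of_forall fun p => by
        simp only [Function.uncurry, Real.norm_eq_abs, abs_pow]
        exact pow_le_pow_left₀ (abs_nonneg _) (hhb p.1 p.2) 2)
  calc ∫ ω, (∫ x, F ω x ∂ν - c) ^ 2 ∂μ
      ≤ ∫ ω, ∫ x, (F ω x - c) ^ 2 ∂ν ∂μ :=
        integral_mono_of_nonneg (Eventually.of_forall fun ω => sq_nonneg _)
          hprod.integral_prod_left (Eventually.of_forall hpt)
    _ = ∫ x, ∫ ω, (F ω x - c) ^ 2 ∂μ ∂ν := integral_integral_swap hprod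

/-- **Transported means at rung 0 from a static second moment.**  For constant profiles the
local Gibbs law `G_N` is flow invariant, so `∫₀¹ E_G[X ∘ Φ_t] dt = E_G[X]`, and
`|E_G X|² ≤ E_G X² ≤ c²` (Jensen). [folklore] -/
theorem abs_setIntegral_mean_flow_le {σ : ℝ} (hσ2 : σ ≤ 1 / 2) {N : ℕ}
    (Φ : HardSphereFlow (Torus.geometry (Fin 3)) (hsDiameter σ N) (N + 1))
    {X : Config (N + 1) (Fin 3) T3 → ℝ} (hXm : Measurable X) {B : ℝ} (hXb : ∀ z, |X z| ≤ B)
    {c : ℝ} (hc : 0 ≤ c)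
    (hS : ∫ z, X z ^ 2 ∂(localGibbsLaw σ (fun _ => (1 : ℝ)) (fun _ => (0 : V3)) (fun _ => (1 : ℝ)) N Φ) ≤ c ^ 2) :
    |∫ t in Icc (0 : ℝ) 1, ∫ z, X (Φ.flow t z)
        ∂(localGibbsLaw σ (fun _ => (1 : ℝ)) (fun _ => (0 : V3)) (fun _ => (1 : ℝ)) N Φ)| ≤ c := by
  haveI : IsProbabilityMeasure (localGibbsLaw σ (fun _ => (1 : ℝ)) (fun _ => (0 : V3)) (fun _ => (1 : ℝ)) N Φ) :=
    isProbabilityMeasure_localGibbsLaw continuous_const continuous_const continuous_const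
      (fun _ => one_pos) (fun _ => one_pos) hσ2 N Φ
  have hinner : ∀ t : ℝ, ∫ z, X (Φ.flow t z)
      ∂(localGibbsLaw σ (fun _ => (1 : ℝ)) (fun _ => (0 : V3)) (fun _ => (1 : ℝ)) N Φ) =
      ∫ z, X z ∂(localGibbsLaw σ (fun _ => (1 : ℝ)) (fun _ => (0 : V3)) (fun _ => (1 : ℝ)) N Φ) :=
    fun t => integral_comp_flow_localGibbsLaw_const σ 1 1 0 N Φ t hXm.aestronglyMeasurable
  simp only [hinner]
  rw [setIntegral_const, Real.volume_real_Icc_of_le zero_le_one, sub_zero, one_smul]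
  have h1 := sq_integral_le_integral_sq_of_abs_le
    (ν := localGibbsLaw σ (fun _ => (1 : ℝ)) (fun _ => (0 : V3)) (fun _ => (1 : ℝ)) N Φ) hXm hXb
  have h2 : |∫ z, X z ∂(localGibbsLaw σ (fun _ => (1 : ℝ)) (fun _ => (0 : V3)) (fun _ => (1 : ℝ)) N Φ)| ^ 2 ≤
      c ^ 2 := by
    rw [sq_abs]; exact h1.trans hS
  exact le_of_pow_le_pow_left₀ two_ne_zero hc h2

/-- **Transported variances at rung 0 are static** (`MeasurePreserving.variance_fun_comp`) and at most
the static second moment. [folklore] -/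
theorem variance_flow_le_integral_sq {σ : ℝ} (hσ2 : σ ≤ 1 / 2) {N : ℕ}
    (Φ : HardSphereFlow (Torus.geometry (Fin 3)) (hsDiameter σ N) (N + 1))
    {X : Config (N + 1) (Fin 3) T3 → ℝ} (hXm : Measurable X) (t : ℝ) :
    variance (fun z => X (Φ.flow t z))
        (localGibbsLaw σ (fun _ => (1 : ℝ)) (fun _ => (0 : V3)) (fun _ => (1 : ℝ)) N Φ) ≤
      ∫ z, X z ^ 2 ∂(localGibbsLaw σ (fun _ => (1 : ℝ)) (fun _ => (0 : V3)) (fun _ => (1 : ℝ)) N Φ) := by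
  haveI : IsProbabilityMeasure (localGibbsLaw σ (fun _ => (1 : ℝ)) (fun _ => (0 : V3)) (fun _ => (1 : ℝ)) N Φ) :=
    isProbabilityMeasure_localGibbsLaw continuous_const continuous_const continuous_const
      (fun _ => one_pos) (fun _ => one_pos) hσ2 N Φ
  rw [(measurePreserving_flow_localGibbsLaw_const σ 1 1 0 N Φ t).variance_fun_comp hXm.aemeasurable]
  have h := variance_le_integral_sub_const_sq
    (μ := localGibbsLaw σ (fun _ => (1 : ℝ)) (fun _ => (0 : V3)) (fun _ => (1 : ℝ)) N Φ)
    hXm.aestronglyMeasurable 0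
  simpa only [sub_zero] using h

/-- **Time averages along the flow are not small** when the static second moment about `0` of a
bounded measurable `X` is `≤ Θ²/64`, `Θ > 0`: `G_N {Θ/2 < |∫₀¹ X(Φ_t z) dt|} ≤ 1/4`
(`measure_lt_abs_setIntegral_flow_le` with `m = Θ/4`, `ς = Θ²/64`). [folklore] -/
theorem measure_lt_abs_timeAvg_le_of_sq_le {σ : ℝ} (hσ2 : σ ≤ 1 / 2) {N : ℕ}
    (Φ : HardSphereFlow (Torus.geometry (Fin 3)) (hsDiameter σ N) (N + 1))
    {X : Config (N + 1) (Fin 3) T3 → ℝ} (hXm : Measurable X) {B : ℝ} (hXb : ∀ z, |X z| ≤ B)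
    {Θ : ℝ} (hΘ : 0 < Θ)
    (hS : ∫ z, X z ^ 2 ∂(localGibbsLaw σ (fun _ => (1 : ℝ)) (fun _ => (0 : V3)) (fun _ => (1 : ℝ)) N Φ) ≤
      Θ ^ 2 / 64) :
    localGibbsLaw σ (fun _ => (1 : ℝ)) (fun _ => (0 : V3)) (fun _ => (1 : ℝ)) N Φ
        {z | Θ / 2 < |∫ t in Icc (0 : ℝ) 1, X (Φ.flow t z)|} ≤ ENNReal.ofReal (1 / 4) := by
  haveI : IsProbabilityMeasure (localGibbsLaw σ (fun _ => (1 : ℝ)) (fun _ => (0 : V3)) (fun _ => (1 : ℝ)) N Φ) :=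
    isProbabilityMeasure_localGibbsLaw continuous_const continuous_const continuous_const
      (fun _ => one_pos) (fun _ => one_pos) hσ2 N Φ
  have hS' : ∫ z, X z ^ 2 ∂(localGibbsLaw σ (fun _ => (1 : ℝ)) (fun _ => (0 : V3)) (fun _ => (1 : ℝ)) N Φ) ≤
      (Θ / 4) ^ 2 := hS.trans (by nlinarith [sq_nonneg Θ])
  have key := measure_lt_abs_setIntegral_flow_le σ (fun _ => (1 : ℝ)) (fun _ => (1 : ℝ))
    (fun _ => (0 : V3)) N Φ (A := fun _ z => X z) (τ := 1) (m := Θ / 4)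
    (ς := Θ ^ 2 / 64) (η := Θ / 2) (B := B)
    (hXm.comp measurable_snd) (fun t _ z => hXb z) one_pos (by linarith)
    (abs_setIntegral_mean_flow_le hσ2 Φ hXm hXb (by positivity) hS')
    (fun t _ => (variance_flow_le_integral_sq hσ2 Φ hXm t).trans hS)
  have e : ENNReal.ofReal ((1 : ℝ) ^ 2 * (Θ ^ 2 / 64) / (Θ / 2 - Θ / 4) ^ 2) =
      ENNReal.ofReal (1 / 4) := by
    congr 1
    field_simp
    ring
  rw [e] at key
  exact key

/-- **Time averages of the weighted Enskog rate are not small at rung 0.**  For the uniform gas at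
small reduced density `σ`, a continuous weight `ψ` with `|ψ| ≤ K` and `ψ(σ³) = 1`, `0 ≤ L`,
`0 < r < 1/2`, any flows `Φ`, and a diagonal truncated mark with Maxwellian pair average `Θ̄ > 0`:
for `N ≥ N₀`,
`G_N {Θ̄/2 < |∫₀¹ ((∫ ψ(σ³ρ_r) B_r(Ξ_L^{kk}) dx)(Φ_t z) − Θ̄) dt|} ≤ 1/4`. [folklore] -/
theorem measure_lt_abs_timeAvg_weightRate_le :
    ∀ {σ : ℝ}, SmallDensity uniformProfile σ → ∀ {ψ : ℝ → ℝ}, Continuous ψ → ∀ {K : ℝ}, (∀ y, |ψ y| ≤ K) →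
      ψ (σ ^ 3) = 1 → ∀ (k : Fin 3) {L r : ℝ}, 0 ≤ L → 0 < r → r < 1 / 2 →
      ∀ Φ : (N : ℕ) → HardSphereFlow (Torus.geometry (Fin 3)) (hsDiameter σ N) (N + 1),
      0 < ∫ p, sphereMark (evenMarkTrunc k k L) p.1 p.2 ∂((gaussMeasure (0 : V3) 1).prod (gaussMeasure (0 : V3) 1)) →
      ∃ N₀ : ℕ, ∀ N : ℕ, N₀ ≤ N →
        localGibbsLaw σ (fun _ => (1 : ℝ)) (fun _ => (0 : V3)) (fun _ => (1 : ℝ)) N (Φ N)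
          {z | (∫ p, sphereMark (evenMarkTrunc k k L) p.1 p.2
                ∂((gaussMeasure (0 : V3) 1).prod (gaussMeasure (0 : V3) 1))) / 2 <
            |∫ t in Set.Icc (0 : ℝ) 1, ((∫ x : T3, ψ (σ ^ 3 * mollDensity r ((Φ N).flow t z) x) *
                pairFunctional r (evenMarkTrunc k k L) ((Φ N).flow t z) x) -
              ∫ p, sphereMark (evenMarkTrunc k k L) p.1 p.2
                ∂((gaussMeasure (0 : V3) 1).prod (gaussMeasure (0 : V3) 1)))|}
          ≤ ENNReal.ofReal (1 / 4) := by
  intro σ hsd ψ hψ K hK hψ1 k L r hL hr hr2 Φ hΘ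
  have hσ2 : σ ≤ 1 / 2 := hsd.σ_lt_half.le
  have hK' : ∀ y, 0 ≤ y → |ψ y| ≤ K := fun y _ => hK y
  have hK0 : 0 ≤ K := (abs_nonneg _).trans (hK 0)
  -- the static mean-square deviation tends to zero
  have hJ := tendsto_integral_integral_sq_deviation (a := 1) (θ := 1) (u := (0 : V3)) hsd one_pos one_pos
    hψ.measurable hK' hψ.continuousAt k k hL hr hr2 Φ
  simp only [hψ1, one_mul] at hJ
  set Θb : ℝ := ∫ p, sphereMark (evenMarkTrunc k k L) p.1 p.2
    ∂((gaussMeasure (0 : V3) 1).prod (gaussMeasure (0 : V3) 1)) with hΘb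
  have hς : 0 < Θb ^ 2 / 64 := by positivity
  obtain ⟨N₀, hN₀⟩ := eventually_atTop.1 (hJ.eventually (gt_mem_nhds hς))
  refine ⟨N₀, fun N hN => ?_⟩
  have hJN := hN₀ N hN
  haveI : IsProbabilityMeasure (localGibbsLaw σ (fun _ => (1 : ℝ)) (fun _ => (0 : V3)) (fun _ => (1 : ℝ)) N (Φ N)) :=
    isProbabilityMeasure_localGibbsLaw continuous_const continuous_const continuous_const
      (fun _ => one_pos) (fun _ => one_pos) hσ2 N (Φ N)
  -- name the weighted rate
  obtain ⟨wR, hwR⟩ : ∃ f : Config (N + 1) (Fin 3) T3 → ℝ, ∀ z, f z =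
      ∫ x : T3, ψ (σ ^ 3 * mollDensity r z x) * pairFunctional r (evenMarkTrunc k k L) z x :=
    ⟨_, fun _ => rfl⟩
  simp only [← hwR]
  have hwRe : wR = fun z => ∫ x : T3, ψ (σ ^ 3 * mollDensity r z x) *
      pairFunctional r (evenMarkTrunc k k L) z x := funext hwR
  set M : ℝ := 3 / (Real.pi * r ^ 3) with hM
  set CΘ : ℝ := 2 * L * (2 * L) * (sphereMeasure : Measure (Metric.sphere (0 : V3) 1)).real univ with hCΘ
  have hwRm : Measurable wR := by
    rw [hwRe]; exact measurable_weightRate σ N hψ (continuous_evenMarkTrunc k k L) r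
  have hwRb : ∀ z, |wR z| ≤ K * (M * M * CΘ) := fun z => by
    rw [hwR]; exact abs_weightRate_evenMarkTrunc_le hK k k hL hr z
  have hXm : Measurable fun z => wR z - Θb := hwRm.sub_const _
  have hXb : ∀ z, |wR z - Θb| ≤ K * (M * M * CΘ) + |Θb| := fun z =>
    (abs_sub _ _).trans (add_le_add (hwRb z) le_rfl)
  -- the static second moment about `Θ̄` is small
  have hFm : Measurable (Function.uncurry fun (z : Config (N + 1) (Fin 3) T3) (x : T3) =>
      ψ (σ ^ 3 * mollDensity r z x) * pairFunctional r (evenMarkTrunc k k L) z x) :=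
    (continuous_weightIntegrand σ N hψ (continuous_evenMarkTrunc k k L) r).measurable
  have hFb : ∀ (z : Config (N + 1) (Fin 3) T3) (x : T3),
      |ψ (σ ^ 3 * mollDensity r z x) * pairFunctional r (evenMarkTrunc k k L) z x| ≤ K * (M * M * CΘ) := by
    intro z x
    rw [abs_mul]
    exact mul_le_mul (hK _) (abs_pairFunctional_evenMarkTrunc_le k k hL hr z x) (abs_nonneg _) hK0
  have hS : ∫ z, (wR z - Θb) ^ 2 ∂(localGibbsLaw σ (fun _ => (1 : ℝ)) (fun _ => (0 : V3)) (fun _ => (1 : ℝ)) N (Φ N))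
      ≤ Θb ^ 2 / 64 := by
    have h := integral_sq_integral_sub_const_le
      (μ := localGibbsLaw σ (fun _ => (1 : ℝ)) (fun _ => (0 : V3)) (fun _ => (1 : ℝ)) N (Φ N))
      (ν := (volume : Measure T3)) hFm hFb Θb
    simp only [← hwR] at h
    exact h.trans hJN.le
  exact measure_lt_abs_timeAvg_le_of_sq_le hσ2 (Φ N) (X := fun z => wR z - Θb) hXm hXb hΘ hS

/-! ## The bump at `η⋆` and the two continuous bounded weights -/

/-- **Bump and weights.**  For two laws `F₁, F₂` continuous on `(0, η_c)` with `F₂ η⋆ < F₁ η⋆`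
(`0 < η⋆ < η_A, η_B, η_c`) there are a continuous bump `0 ≤ g ≤ 1` with `g η⋆ = 1`, vanishing on
`[η_A, ∞)` and on `[η_B, ∞)`, and continuous bounded weights `wᵢ` with `g · Fᵢ = wᵢ` everywhere and
`(F₁ η⋆ − F₂ η⋆)/2 · g ≤ w₁ − w₂` (a piecewise-linear bump supported in a continuity window of
`F₁ − F₂` around `η⋆`, and `wᵢ = g · (Fᵢ ∘ clamp)` with the clamp onto that window). [folklore] -/
theorem exists_bump_weights {F₁ F₂ : ℝ → ℝ} {ηA ηB ηc ηs : ℝ}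
    (hF₁ : ContinuousOn F₁ (Ioo 0 ηc)) (hF₂ : ContinuousOn F₂ (Ioo 0 ηc))
    (hηs : 0 < ηs) (hsA : ηs < ηA) (hsB : ηs < ηB) (hsc : ηs < ηc) (hlt : F₂ ηs < F₁ ηs) :
    ∃ g w₁ w₂ : ℝ → ℝ, ∃ K₁ K₂ : ℝ,
      Continuous g ∧ Continuous w₁ ∧ Continuous w₂ ∧
      (∀ a, 0 ≤ g a) ∧ (∀ a, |g a| ≤ 1) ∧ g ηs = 1 ∧
      (∀ a, ηA ≤ a → g a = 0) ∧ (∀ a, ηB ≤ a → g a = 0) ∧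
      (∀ a, g a * F₁ a = w₁ a) ∧ (∀ a, g a * F₂ a = w₂ a) ∧
      (∀ a, |w₁ a| ≤ K₁) ∧ (∀ a, |w₂ a| ≤ K₂) ∧
      (∀ a, (F₁ ηs - F₂ ηs) / 2 * g a ≤ w₁ a - w₂ a) := by
  set d : ℝ := F₁ ηs - F₂ ηs with hd
  have hdpos : 0 < d := sub_pos.2 hlt
  -- a continuity window of half-width `2ι` around `η⋆`
  have hmem : Ioo 0 ηc ∈ 𝓝 ηs := isOpen_Ioo.mem_nhds ⟨hηs, hsc⟩
  obtain ⟨δ₁, hδ₁, hδ₁F⟩ := Metric.continuousAt_iff.1 (hF₁.continuousAt hmem) (d / 4) (by positivity)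
  obtain ⟨δ₂, hδ₂, hδ₂F⟩ := Metric.continuousAt_iff.1 (hF₂.continuousAt hmem) (d / 4) (by positivity)
  have hm0 : 0 < min (min δ₁ δ₂) (min ηs (min (ηA - ηs) (min (ηB - ηs) (ηc - ηs)))) :=
    lt_min (lt_min hδ₁ hδ₂) (lt_min hηs (lt_min (by linarith) (lt_min (by linarith) (by linarith))))
  obtain ⟨ι, hιdef⟩ : ∃ ι : ℝ, ι = min (min δ₁ δ₂) (min ηs (min (ηA - ηs) (min (ηB - ηs) (ηc - ηs)))) / 4 :=
    ⟨_, rfl⟩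
  have hι : 0 < ι := by rw [hιdef]; positivity
  have hmδ₁ : min (min δ₁ δ₂) (min ηs (min (ηA - ηs) (min (ηB - ηs) (ηc - ηs)))) ≤ δ₁ :=
    (min_le_left _ _).trans (min_le_left _ _)
  have hmδ₂ : min (min δ₁ δ₂) (min ηs (min (ηA - ηs) (min (ηB - ηs) (ηc - ηs)))) ≤ δ₂ :=
    (min_le_left _ _).trans (min_le_right _ _)
  have hms : min (min δ₁ δ₂) (min ηs (min (ηA - ηs) (min (ηB - ηs) (ηc - ηs)))) ≤ ηs :=
    (min_le_right _ _).trans (min_le_left _ _)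
  have hmA : min (min δ₁ δ₂) (min ηs (min (ηA - ηs) (min (ηB - ηs) (ηc - ηs)))) ≤ ηA - ηs :=
    (min_le_right _ _).trans ((min_le_right _ _).trans (min_le_left _ _))
  have hmB : min (min δ₁ δ₂) (min ηs (min (ηA - ηs) (min (ηB - ηs) (ηc - ηs)))) ≤ ηB - ηs :=
    (min_le_right _ _).trans ((min_le_right _ _).trans ((min_le_right _ _).trans (min_le_left _ _)))
  have hmc : min (min δ₁ δ₂) (min ηs (min (ηA - ηs) (min (ηB - ηs) (ηc - ηs)))) ≤ ηc - ηs :=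
    (min_le_right _ _).trans ((min_le_right _ _).trans ((min_le_right _ _).trans (min_le_right _ _)))
  have h2ιδ₁ : 2 * ι < δ₁ := by rw [hιdef]; linarith
  have h2ιδ₂ : 2 * ι < δ₂ := by rw [hιdef]; linarith
  have h2ιs : 2 * ι < ηs := by rw [hιdef]; linarith
  have hA2 : ηs + 2 * ι < ηA := by rw [hιdef]; linarith
  have hB2 : ηs + 2 * ι < ηB := by rw [hιdef]; linarith
  have hc2 : ηs + 2 * ι < ηc := by rw [hιdef]; linarith
  have hgap : ∀ a, |a - ηs| ≤ 2 * ι → d / 2 ≤ F₁ a - F₂ a := by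
    intro a ha
    have e1 : dist (F₁ a) (F₁ ηs) < d / 4 := hδ₁F (by rw [Real.dist_eq]; linarith)
    have e2 : dist (F₂ a) (F₂ ηs) < d / 4 := hδ₂F (by rw [Real.dist_eq]; linarith)
    rw [Real.dist_eq, abs_lt] at e1 e2
    rw [hd]
    linarith [e1.1, e1.2, e2.1, e2.2]
  -- the bump
  obtain ⟨g, hg⟩ : ∃ g : ℝ → ℝ, ∀ a, g a = min 1 (max 0 ((2 * ι - |a - ηs|) / ι)) := ⟨_, fun _ => rfl⟩
  have hgc : Continuous g := by
    rw [show g = fun a => min 1 (max 0 ((2 * ι - |a - ηs|) / ι)) from funext hg]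
    exact continuous_const.min (continuous_const.max
      ((continuous_const.sub ((continuous_id.sub continuous_const).abs)).div_const ι))
  have hg01 : ∀ a, 0 ≤ g a ∧ g a ≤ 1 := fun a => by
    rw [hg]; exact ⟨le_min zero_le_one (le_max_left _ _), min_le_left _ _⟩
  have hg0 : ∀ a, 2 * ι ≤ |a - ηs| → g a = 0 := fun a ha => by
    rw [hg]
    have : (2 * ι - |a - ηs|) / ι ≤ 0 := div_nonpos_iff.2 (Or.inr ⟨by linarith, hι.le⟩)
    rw [max_eq_left this, min_eq_right zero_le_one]
  have hgsupp : ∀ a, g a ≠ 0 → |a - ηs| < 2 * ι := fun a h => not_le.1 (mt (hg0 a) h)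
  have hgs : g ηs = 1 := by
    rw [hg, sub_self, abs_zero, sub_zero, mul_div_assoc, div_self hι.ne', mul_one,
      max_eq_right (by norm_num : (0 : ℝ) ≤ 2), min_eq_left (by norm_num : (1 : ℝ) ≤ 2)]
  have hgA : ∀ a, ηA ≤ a → g a = 0 := fun a ha =>
    hg0 a (by rw [abs_of_pos (by linarith)]; linarith)
  have hgB : ∀ a, ηB ≤ a → g a = 0 := fun a ha =>
    hg0 a (by rw [abs_of_pos (by linarith)]; linarith)
  have hgK : ∀ a, |g a| ≤ 1 := fun a => by rw [abs_of_nonneg (hg01 a).1]; exact (hg01 a).2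
  -- the clamp onto the window and the weights
  obtain ⟨cl, hcl⟩ : ∃ cl : ℝ → ℝ, ∀ a, cl a = max (ηs - 2 * ι) (min a (ηs + 2 * ι)) :=
    ⟨_, fun _ => rfl⟩
  have hclc : Continuous cl := by
    rw [show cl = fun a => max (ηs - 2 * ι) (min a (ηs + 2 * ι)) from funext hcl]
    exact continuous_const.max (continuous_id.min continuous_const)
  have hclmem : ∀ a, cl a ∈ Icc (ηs - 2 * ι) (ηs + 2 * ι) := fun a => by
    rw [hcl]; exact ⟨le_max_left _ _, max_le (by linarith) (min_le_right _ _)⟩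
  have hclwin : ∀ a, |cl a - ηs| ≤ 2 * ι := fun a => by
    have h := hclmem a
    rw [abs_le]; constructor <;> linarith [h.1, h.2]
  have hcleq : ∀ a, |a - ηs| ≤ 2 * ι → cl a = a := fun a ha => by
    rw [abs_le] at ha
    rw [hcl, min_eq_left (by linarith), max_eq_right (by linarith)]
  have hIcc : Icc (ηs - 2 * ι) (ηs + 2 * ι) ⊆ Ioo 0 ηc := fun a ha =>
    ⟨by linarith [ha.1], by linarith [ha.2]⟩
  obtain ⟨K₁, hK₁⟩ := (isCompact_Icc : IsCompact (Icc (ηs - 2 * ι) (ηs + 2 * ι))).exists_bound_of_continuousOn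
    (hF₁.mono hIcc)
  obtain ⟨K₂, hK₂⟩ := (isCompact_Icc : IsCompact (Icc (ηs - 2 * ι) (ηs + 2 * ι))).exists_bound_of_continuousOn
    (hF₂.mono hIcc)
  refine ⟨g, fun a => g a * F₁ (cl a), fun a => g a * F₂ (cl a), K₁, K₂, hgc,
    hgc.mul (hF₁.comp_continuous hclc fun a => hIcc (hclmem a)),
    hgc.mul (hF₂.comp_continuous hclc fun a => hIcc (hclmem a)),
    fun a => (hg01 a).1, hgK, hgs, hgA, hgB, fun a => ?_, fun a => ?_, fun a => ?_, fun a => ?_, fun a => ?_⟩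
  · show g a * F₁ a = g a * F₁ (cl a)
    by_cases h : g a = 0
    · rw [h, zero_mul, zero_mul]
    · rw [hcleq a (hgsupp a h).le]
  · show g a * F₂ a = g a * F₂ (cl a)
    by_cases h : g a = 0
    · rw [h, zero_mul, zero_mul]
    · rw [hcleq a (hgsupp a h).le]
  · show |g a * F₁ (cl a)| ≤ K₁
    rw [abs_mul]
    have h1 : |F₁ (cl a)| ≤ K₁ := by simpa only [Real.norm_eq_abs] using hK₁ (cl a) (hclmem a)
    calc |g a| * |F₁ (cl a)| ≤ 1 * K₁ := mul_le_mul (hgK a) h1 (abs_nonneg _) zero_le_one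
      _ = K₁ := one_mul _
  · show |g a * F₂ (cl a)| ≤ K₂
    rw [abs_mul]
    have h1 : |F₂ (cl a)| ≤ K₂ := by simpa only [Real.norm_eq_abs] using hK₂ (cl a) (hclmem a)
    calc |g a| * |F₂ (cl a)| ≤ 1 * K₂ := mul_le_mul (hgK a) h1 (abs_nonneg _) zero_le_one
      _ = K₂ := one_mul _
  · show d / 2 * g a ≤ g a * F₁ (cl a) - g a * F₂ (cl a)
    calc d / 2 * g a = g a * (d / 2) := mul_comm _ _
      _ ≤ g a * (F₁ (cl a) - F₂ (cl a)) := mul_le_mul_of_nonneg_left (hgap (cl a) (hclwin a)) (hg01 a).1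
      _ = g a * F₁ (cl a) - g a * F₂ (cl a) := mul_sub _ _ _

/-- The contact value `Y = (3/2π)·f_ex′` is continuous on the open analyticity band `(0, η₀)` of the
equation of state (`deriv f_ex = F′` there, `Filter.EventuallyEq.deriv_eq`; no continuity at `0` is
claimed). [folklore] -/
theorem continuousOn_contactValue_band :
    ∃ η₀ : ℝ, 0 < η₀ ∧ ContinuousOn contactValue (Ioo 0 η₀) := by
  -- buildfix 2026-08-19: the route file's `HsEosLowDensity_holds` link is gone; use the landed proof of the
  -- (verbatim identical) ImplosionDichotomy decl directly.
  obtain ⟨η₀, hη₀, F, hF, hEq, -, -, -⟩ :=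
    Summit.AtomisticToContinuum.HydrodynamicLimit.Theorems.hsEosLowDensity_proof
  refine ⟨η₀, hη₀, ?_⟩
  have h1 : ContinuousOn (fun a => 3 / (2 * Real.pi) * deriv F a) (Ioo 0 η₀) :=
    continuousOn_const.mul (hF.deriv.continuousOn.mono (Ioo_subset_Ioo (by linarith) le_rfl))
  refine h1.congr fun a ha => ?_
  have hnhds : hsExcessFreeEnergy =ᶠ[𝓝 a] F :=
    Filter.eventuallyEq_of_mem (isOpen_Ioo.mem_nhds ha) (hEq.mono Ioo_subset_Ico_self)
  rw [contactValue, hnhds.deriv_eq]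


end Summit.AtomisticToContinuum.HydrodynamicLimit.Theorems.EvenStressEnskog

end
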